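import Summits.AtomisticToContinuum.BoseEinsteinCondensation.Theses.BECDistantTilts
import Literature.MathematicalPhysics.QuantumManyBody.OneParticleMarginals

/-!
# Crux `TiltCommutation` (stmt-AtomisticToContinuum-12177) — birth skeleton (line `birth`)

Route `BECDistantTilts` (route-AtomisticToContinuum-BECDistantTilts), sub-problem
`BoseEinsteinCondensation`.  The crux says: in density-weighted mean total variation,
`∫dx ∫dY |N|Φ(x,Y)|² − ρ_Φ(x) π_x(Y)| ≤ η N` eventually, i.e. the Palm law of the Dirichlet
ground-state measure `|Φ|²` at `x` is the periodic-insertion (Papangelou) tilt `π_x` of the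
wall-tilted `(N−1)`-marginal `m_Φ`.

This skeleton is the route's own foreseen first split of the crux ("TWO-LAYER PLAN":
`CrossInfluenceDecay` with a rate in the distance to the walls, integrated against the density),
typed as two stubs and a kernel-checked assembly:

* `stub_bulkPalmTilt : BulkPalmTilt` — **pointwise (a.e.) tilt commutation in the bulk with a
  rate**: for every tolerance `ε` there is a wall distance `d = d(v, ρ, ε)` such that, for all
  large `N`, at almost every point `x` of the inner box `{d ≤ x_k ≤ L − d}` the total variation
  between the Palm law at `x` and the tilt `π_x` is `≤ ε ρ_Φ(x)`.  This is the Dobrushin-type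
  decay of the wall×tag connected influence (the load-bearing stub; uniform in the bulk point,
  which the integrated crux does not ask for, and silent about the boundary layer, which the crux
  does constrain).
* `stub_boundaryLayerMass : BoundaryLayerMass` — **no boundary accumulation**: for every FIXED
  width `d`, the one-particle density of a Dirichlet ground state puts mass `o(N)` in the layer
  of width `d` along the walls (complement of the inner box) as `L = (N/ρ)^{1/3} → ∞`
  (heuristically `≤ 6 d ρ_max L² = O(N d / L)`); a pure density statement, no `Θ`, no tilt.
* `TiltCommutation_of : BulkPalmTilt → BoundaryLayerMass → TiltCommutation` (hypotheses spelled
  `__Registered.stub_X`, `rfl`-aliases keyed by the stub names, for the native audit) — PROVED here: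
  split `∫dx` into inner box and layer (`lintegral_add_compl`); in the bulk integrate the a.e.
  bound against `ρ_Φ` and use `∫ρ_Φ = N` (Tonelli over the tagged particle,
  `lintegral_sliceMass`); in the layer use the pointwise bound
  `∫dY |a − ρπ| + |ρπ − a| ≤ ∫a + ρ∫π ≤ 2ρ_Φ(x)` (`∫π_x ≤ 1` in every `ℝ≥0∞` corner, by
  measurability of the tilt numerator) and the layer-mass bound; `ε = η/3`.

Helper lemmas below are sorry-free; the only `sorry`s are the two `stub_*`.
-/

noncomputable section

open MeasureTheory Filter Set
open scoped ENNReal NNReal Topology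

namespace Summit.AtomisticToContinuum.BoseEinsteinCondensation.Cruxes.TiltCommutation.Birth

open Literature.MathematicalPhysics.QuantumManyBody.BoseGas
open Summit.AtomisticToContinuum.BoseEinsteinCondensation.Theses.BECDistantTilts (TiltCommutation)

/-! ### Stub statements -/

/-- **Bulk Palm–tilt commutation with a rate (pointwise a.e. in the inner box).**
For every repulsive finite-range `v` there is `ρ₀ > 0` such that for `0 < ρ < ρ₀` and every
`ε > 0` there is a wall distance `d > 0` with: for all large `N = n+1` (`L = (N/ρ)^{1/3}`), for
every Dirichlet ground state `Φ` and periodic ground state `Θ` (same predicates as the crux) and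
the crux's `ρ_Φ, m_Φ, λ, π`, for a.e. `x` with `d ≤ x_k ≤ L − d` (`k = 1,2,3`):
`∫dY |N|Φ(x,Y)|² − ρ_Φ(x)π_x(Y)| ≤ ε ρ_Φ(x)` (symmetrised truncated differences, as in the crux).
Why plausibly true: the wall×tag connected influence at distance `d` from the walls is
heuristically `(ξ/d)² √(ρa³)`, uniformly in `L`; exact (`= 0`) at `v = 0`.  Size: XL (this is
where the influence technology lives).  Leans on: nothing in the tree beyond the definitions. -/
def BulkPalmTilt : Prop :=
  ∀ v : ℝ → ℝ≥0∞, IsRepulsiveFiniteRange v → ∃ ρ₀ : ℝ, 0 < ρ₀ ∧ ∀ ρ : ℝ, 0 < ρ → ρ < ρ₀ →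
    ∀ ε : ℝ, 0 < ε → ∃ d : ℝ, 0 < d ∧ ∀ᶠ n : ℕ in Filter.atTop, ∀ L : ℝ, L = sideLength ρ (n + 1) →
    ∀ Φ : Config (n + 1) → ℂ, (Measurable Φ ∧ (∀ X, X ∉ boxN (n + 1) L → Φ X = 0) ∧
      (∫⁻ X, (‖Φ X‖₊ : ENNReal) ^ 2) = 1 ∧ groundStateEnergy v (n + 1) L ≠ ⊤ ∧
      ∃ Ψ : ℕ → TrialState (n + 1) L,
        Filter.Tendsto (fun k => energy v (Ψ k)) Filter.atTop (nhds (groundStateEnergy v (n + 1) L)) ∧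
        Filter.Tendsto (fun k => ∫⁻ X, (‖(Ψ k).ψ X - Φ X‖₊ : ENNReal) ^ 2) Filter.atTop (nhds 0)) →
    ∀ Θ : Config (n + 1) → ℂ, (Measurable Θ ∧ (∫⁻ X in cellN (n + 1) L, (‖Θ X‖₊ : ENNReal) ^ 2) = 1 ∧
      periodicGroundStateEnergy v (n + 1) L ≠ ⊤ ∧
      ∃ Ψ : ℕ → PeriodicTrialState (n + 1) L,
        Filter.Tendsto (fun k => periodicEnergy v (Ψ k)) Filter.atTop
          (nhds (periodicGroundStateEnergy v (n + 1) L)) ∧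
        Filter.Tendsto (fun k => ∫⁻ X in cellN (n + 1) L, (‖(Ψ k).ψ X - Θ X‖₊ : ENNReal) ^ 2)
          Filter.atTop (nhds 0)) →
    ∀ ρΦ : Space → ENNReal, ρΦ = (fun x => ((n : ENNReal) + 1) *
      ∫⁻ Y : Config n, (‖Φ (Matrix.vecCons x Y)‖₊ : ENNReal) ^ 2) →
    ∀ mΦ : Config n → ENNReal, mΦ = (fun Y => ∫⁻ z : Space, (‖Φ (Matrix.vecCons z Y)‖₊ : ENNReal) ^ 2) →
    ∀ lam : Space → Config n → ENNReal, lam = (fun x Y =>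
      ((cellN (n + 1) L).indicator (fun X => (‖Θ X‖₊ : ENNReal) ^ 2) (Matrix.vecCons x Y)) /
        ∫⁻ z : Space, ((cellN (n + 1) L).indicator (fun X => (‖Θ X‖₊ : ENNReal) ^ 2)
          (Matrix.vecCons z Y))) →
    ∀ π : Space → Config n → ENNReal, π = (fun x Y => lam x Y * mΦ Y / ∫⁻ W : Config n, lam x W * mΦ W) →
    ∀ᵐ x : Space, (∀ k, d ≤ x k ∧ x k ≤ L - d) →
      ∫⁻ Y : Config n, ((((n : ENNReal) + 1) * (‖Φ (Matrix.vecCons x Y)‖₊ : ENNReal) ^ 2 - ρΦ x * π x Y) +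
        (ρΦ x * π x Y - ((n : ENNReal) + 1) * (‖Φ (Matrix.vecCons x Y)‖₊ : ENNReal) ^ 2))
        ≤ ENNReal.ofReal ε * ρΦ x

/-- **No boundary accumulation of the one-particle density (layer mass `o(N)`).**
For every repulsive finite-range `v` there is `ρ₀ > 0` such that for `0 < ρ < ρ₀`, every fixed
width `d > 0` and every `ε > 0`: for all large `N = n+1` (`L = (N/ρ)^{1/3}`) and every Dirichlet
ground state `Φ` (same predicate as the crux), the mass of `ρ_Φ(x) = N∫|Φ(x,Y)|²dY` outside the
inner box `{d ≤ x_k ≤ L − d}` is `≤ ε N`.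
Why plausibly true: Dirichlet walls deplete rather than attract; with any a-priori bound
`ρ_Φ ≲ ρ` near the walls the layer carries `≲ 6 d ρ L² = 6 d N / L → 0 · N`; for `v = 0`
(sine product) it is `≤ 48 d N / L`.  Size: M–L (needs a local density / no-accumulation bound
for the interacting Dirichlet ground state; not in the tree).  Leans on: definitions only. -/
def BoundaryLayerMass : Prop :=
  ∀ v : ℝ → ℝ≥0∞, IsRepulsiveFiniteRange v → ∃ ρ₀ : ℝ, 0 < ρ₀ ∧ ∀ ρ : ℝ, 0 < ρ → ρ < ρ₀ →
    ∀ d : ℝ, 0 < d → ∀ ε : ℝ, 0 < ε → ∀ᶠ n : ℕ in Filter.atTop, ∀ L : ℝ, L = sideLength ρ (n + 1) →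
    ∀ Φ : Config (n + 1) → ℂ, (Measurable Φ ∧ (∀ X, X ∉ boxN (n + 1) L → Φ X = 0) ∧
      (∫⁻ X, (‖Φ X‖₊ : ENNReal) ^ 2) = 1 ∧ groundStateEnergy v (n + 1) L ≠ ⊤ ∧
      ∃ Ψ : ℕ → TrialState (n + 1) L,
        Filter.Tendsto (fun k => energy v (Ψ k)) Filter.atTop (nhds (groundStateEnergy v (n + 1) L)) ∧
        Filter.Tendsto (fun k => ∫⁻ X, (‖(Ψ k).ψ X - Φ X‖₊ : ENNReal) ^ 2) Filter.atTop (nhds 0)) →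
    ∀ ρΦ : Space → ENNReal, ρΦ = (fun x => ((n : ENNReal) + 1) *
      ∫⁻ Y : Config n, (‖Φ (Matrix.vecCons x Y)‖₊ : ENNReal) ^ 2) →
    ∫⁻ x in {x : Space | ∀ k, d ≤ x k ∧ x k ≤ L - d}ᶜ, ρΦ x ≤ ENNReal.ofReal ε * ((n : ENNReal) + 1)

/-! ### Registered stubs -/

/-- Stub 1 (load-bearing, XL): bulk Palm–tilt commutation with a rate. -/
theorem stub_bulkPalmTilt : BulkPalmTilt := by
  sorry

/-- Stub 2 (M–L): the boundary layer of fixed width carries `o(N)` particles. -/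
theorem stub_boundaryLayerMass : BoundaryLayerMass := by
  sorry

/-! ### Name-keyed aliases of the two stub statements — the hypotheses of `TiltCommutation_of`

The native skeleton audit (`#h21_check_skeleton`) admits a hypothesis of the skeleton theorem only if its
head constant is a registered obligation or is NAMED like a declared stub; `__Registered.stub_X` is the
statement of `stub_X` under that name (device of the sibling skeleton `Cruxes/AmplitudeLDP/Lines/birth.lean`;
the `__` namespace is an implementation detail, and the gate-reserved `@[stub]` attribute is not written by a
planner). Each alias is `rfl`-equal to its statement. -/
namespace __Registered

/-- Alias of `BulkPalmTilt` keyed by the registered stub name. -/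
abbrev stub_bulkPalmTilt : Prop := BulkPalmTilt
/-- Alias of `BoundaryLayerMass` keyed by the registered stub name. -/
abbrev stub_boundaryLayerMass : Prop := BoundaryLayerMass

end __Registered

/-! ### Sorry-free helpers for the assembly -/

/-- The inner box `{d ≤ x_k ≤ L - d}` is measurable. -/
theorem measurableSet_bulk (d L : ℝ) :
    MeasurableSet {x : Space | ∀ k, d ≤ x k ∧ x k ≤ L - d} := by
  have : {x : Space | ∀ k, d ≤ x k ∧ x k ≤ L - d} =
      ⋂ k : Fin 3, (fun x : Space => x k) ⁻¹' Set.Icc d (L - d) := by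
    ext x; simp [Set.mem_Icc]
  rw [this]
  exact MeasurableSet.iInter fun k => measurableSet_Icc.preimage (by fun_prop)

/-- The `N`-particle cell is measurable (reproved here to keep the imports light). -/
theorem measurableSet_cellN' (N : ℕ) (L : ℝ) : MeasurableSet (cellN N L) := by
  have : cellN N L = ⋂ i : Fin N, (fun X : Config N => X i) ⁻¹' cell L := by
    ext X; simp [cellN]
  rw [this]
  exact MeasurableSet.iInter fun i => (measurableSet_cell L).preimage (measurable_pi_apply i)

/-- A tilt `g / ∫g` of a measurable weight is measurable and has total mass `≤ 1` in EVERY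
`ℝ≥0∞` corner (`∫g = 0`: the tilt vanishes a.e.; `∫g = ∞`: the tilt is `0`). -/
theorem tilt_aux {β : Type*} [MeasurableSpace β] {μ : Measure β} {g : β → ℝ≥0∞}
    (hg : Measurable g) :
    Measurable (fun y => g y / ∫⁻ w, g w ∂μ) ∧ ∫⁻ y, g y / (∫⁻ w, g w ∂μ) ∂μ ≤ 1 := by
  refine ⟨hg.div measurable_const, ?_⟩
  simp_rw [div_eq_mul_inv]
  rw [lintegral_mul_const _ hg]
  rcases eq_or_ne (∫⁻ w, g w ∂μ) 0 with h0 | h0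
  · simp [h0]
  rcases eq_or_ne (∫⁻ w, g w ∂μ) ⊤ with ht | ht
  · simp [ht]
  exact (ENNReal.mul_inv_cancel h0 ht).le

/-- Layer bound, abstract form: `∫ (|a − r p| + |r p − a|) ≤ ∫a + r∫p ≤ 2r` when `∫a = r` and
`∫p ≤ 1` (truncated subtraction in `ℝ≥0∞`). -/
theorem lintegral_symmDiff_le {β : Type*} [MeasurableSpace β] {μ : Measure β}
    {a p : β → ℝ≥0∞} (ha : Measurable a) (hp : Measurable p) (hp1 : ∫⁻ y, p y ∂μ ≤ 1)
    {r : ℝ≥0∞} (hr : ∫⁻ y, a y ∂μ = r) :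
    ∫⁻ y, ((a y - r * p y) + (r * p y - a y)) ∂μ ≤ 2 * r := by
  calc ∫⁻ y, ((a y - r * p y) + (r * p y - a y)) ∂μ
      ≤ ∫⁻ y, (a y + r * p y) ∂μ := lintegral_mono fun y => add_le_add tsub_le_self tsub_le_self
    _ = ∫⁻ y, a y ∂μ + ∫⁻ y, r * p y ∂μ := lintegral_add_left ha _
    _ = r + r * ∫⁻ y, p y ∂μ := by rw [hr, lintegral_const_mul _ hp]
    _ ≤ r + r * 1 := by gcongr
    _ = 2 * r := by ring

/-- Total mass of the one-particle density: `∫ ρ_Φ = N` for a normalised `Φ` (Tonelli over the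
tagged particle). -/
theorem lintegral_density {n : ℕ} {Φ : Config (n + 1) → ℂ} (hΦ : Measurable Φ)
    (hnorm : ∫⁻ X, (‖Φ X‖₊ : ℝ≥0∞) ^ 2 = 1) :
    ∫⁻ x : Space, ((n : ℝ≥0∞) + 1) * ∫⁻ Y : Config n, (‖Φ (Matrix.vecCons x Y)‖₊ : ℝ≥0∞) ^ 2
      = (n : ℝ≥0∞) + 1 := by
  have h1 : ∫⁻ x : Space, ∫⁻ Y : Config n, (‖Φ (Matrix.vecCons x Y)‖₊ : ℝ≥0∞) ^ 2 = 1 := by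
    rw [← hnorm]
    exact lintegral_sliceMass hΦ
  rw [lintegral_const_mul' _ _ (by simp), h1, mul_one]

/-! ### The assembly: the two stubs imply the crux, by name -/

/-- **Assembly.** `BulkPalmTilt → BoundaryLayerMass → TiltCommutation`: split the `x`-integral
into the inner box of width `d(η/3)` and the layer; bulk `≤ (η/3)∫ρ_Φ = (η/3)N`, layer
`≤ 2 · (layer mass) ≤ (2η/3)N`. -/
theorem TiltCommutation_of (hA : __Registered.stub_bulkPalmTilt)
    (hB : __Registered.stub_boundaryLayerMass) : TiltCommutation := by
  intro v hv
  obtain ⟨ρ₁, hρ₁, H₁⟩ := hA v hv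
  obtain ⟨ρ₂, hρ₂, H₂⟩ := hB v hv
  refine ⟨min ρ₁ ρ₂, lt_min hρ₁ hρ₂, fun ρ hρ hρlt η hη => ?_⟩
  have hρ1 : ρ < ρ₁ := lt_of_lt_of_le hρlt (min_le_left _ _)
  have hρ2 : ρ < ρ₂ := lt_of_lt_of_le hρlt (min_le_right _ _)
  have hε : (0 : ℝ) < η / 3 := by positivity
  obtain ⟨d, hd, HA⟩ := H₁ ρ hρ hρ1 (η / 3) hε
  have HB := H₂ ρ hρ hρ2 d hd (η / 3) hε
  filter_upwards [HA, HB] with n hnA hnB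
  intro L hL Φ hΦ Θ hΘ ρΦ hρΦ mΦ hmΦ lam hlam π hπ
  -- the data
  set B : Set Space := {x : Space | ∀ k, d ≤ x k ∧ x k ≤ L - d} with hBdef
  have hBm : MeasurableSet B := measurableSet_bulk d L
  set F : Space → ℝ≥0∞ := fun x => ∫⁻ Y : Config n,
    ((((n : ENNReal) + 1) * (‖Φ (Matrix.vecCons x Y)‖₊ : ENNReal) ^ 2 - ρΦ x * π x Y) +
      (ρΦ x * π x Y - ((n : ENNReal) + 1) * (‖Φ (Matrix.vecCons x Y)‖₊ : ENNReal) ^ 2)) with hFdef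
  -- the two stub outputs at this `n`
  have hAx : ∀ᵐ x : Space, x ∈ B → F x ≤ ENNReal.ofReal (η / 3) * ρΦ x :=
    hnA L hL Φ hΦ Θ hΘ ρΦ hρΦ mΦ hmΦ lam hlam π hπ
  have hBx : ∫⁻ x in Bᶜ, ρΦ x ≤ ENNReal.ofReal (η / 3) * ((n : ENNReal) + 1) :=
    hnB L hL Φ hΦ ρΦ hρΦ
  -- total mass `∫ ρ_Φ = N`
  have hρΦx : ∀ x, ρΦ x = ((n : ENNReal) + 1) *
      ∫⁻ Y : Config n, (‖Φ (Matrix.vecCons x Y)‖₊ : ENNReal) ^ 2 := fun x => congrFun hρΦ x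
  have hmass : ∫⁻ x, ρΦ x = (n : ENNReal) + 1 := by
    rw [hρΦ]
    exact lintegral_density hΦ.1 hΦ.2.2.1
  -- the tilt `π_x` is measurable with mass `≤ 1`, for every `x`
  have hπx : ∀ x, Measurable (π x) ∧ ∫⁻ Y, π x Y ≤ 1 := by
    intro x
    have hG : Measurable ((cellN (n + 1) L).indicator fun X : Config (n + 1) => (‖Θ X‖₊ : ℝ≥0∞) ^ 2) :=
      (hΘ.1.nnnorm.coe_nnreal_ennreal.pow_const 2).indicator (measurableSet_cellN' (n + 1) L)
    have hg : Measurable fun Y => lam x Y * mΦ Y := by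
      subst hlam hmΦ
      exact ((hG.comp (measurable_vecCons_right x)).div
        ((hG.comp measurable_vecCons).lintegral_prod_left')).mul
        (((hΦ.1.nnnorm.coe_nnreal_ennreal.pow_const 2).comp measurable_vecCons).lintegral_prod_left')
    have key := tilt_aux (μ := volume) hg
    rw [show π x = fun Y => lam x Y * mΦ Y / ∫⁻ W, lam x W * mΦ W from congrFun hπ x]
    exact key
  -- pointwise layer bound `F x ≤ 2 ρ_Φ(x)` for every `x`
  have hpt : ∀ x, F x ≤ 2 * ρΦ x := fun x =>
    lintegral_symmDiff_le ((measurable_nnnorm_vecCons_sq hΦ.1 x).const_mul _) (hπx x).1 (hπx x).2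
      (by rw [hρΦx x, lintegral_const_mul _ (measurable_nnnorm_vecCons_sq hΦ.1 x)])
  -- assemble
  have hsplit : ∫⁻ x, F x = (∫⁻ x in B, F x) + ∫⁻ x in Bᶜ, F x :=
    (lintegral_add_compl (μ := volume) F hBm).symm
  have hbulk : ∫⁻ x in B, F x ≤ ENNReal.ofReal (η / 3) * ((n : ENNReal) + 1) := by
    calc ∫⁻ x in B, F x ≤ ∫⁻ x in B, ENNReal.ofReal (η / 3) * ρΦ x :=
          lintegral_mono_ae ((ae_restrict_iff' hBm).mpr hAx)
      _ = ENNReal.ofReal (η / 3) * ∫⁻ x in B, ρΦ x :=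
          lintegral_const_mul' _ _ ENNReal.ofReal_ne_top
      _ ≤ ENNReal.ofReal (η / 3) * ∫⁻ x, ρΦ x :=
          mul_le_mul' le_rfl (setLIntegral_le_lintegral B ρΦ)
      _ = ENNReal.ofReal (η / 3) * ((n : ENNReal) + 1) := by rw [hmass]
  have hlayer : ∫⁻ x in Bᶜ, F x ≤ 2 * (ENNReal.ofReal (η / 3) * ((n : ENNReal) + 1)) := by
    calc ∫⁻ x in Bᶜ, F x ≤ ∫⁻ x in Bᶜ, 2 * ρΦ x := lintegral_mono fun x => hpt x
      _ = 2 * ∫⁻ x in Bᶜ, ρΦ x := lintegral_const_mul' _ _ (by simp)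
      _ ≤ 2 * (ENNReal.ofReal (η / 3) * ((n : ENNReal) + 1)) := by
          gcongr
  have h3 : (3 : ℝ≥0∞) * ENNReal.ofReal (η / 3) = ENNReal.ofReal η := by
    rw [← ENNReal.ofReal_ofNat 3, ← ENNReal.ofReal_mul (by norm_num)]
    congr 1
    ring
  calc ∫⁻ x, F x = (∫⁻ x in B, F x) + ∫⁻ x in Bᶜ, F x := hsplit
    _ ≤ ENNReal.ofReal (η / 3) * ((n : ENNReal) + 1) +
          2 * (ENNReal.ofReal (η / 3) * ((n : ENNReal) + 1)) := add_le_add hbulk hlayer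
    _ = (3 : ℝ≥0∞) * ENNReal.ofReal (η / 3) * ((n : ENNReal) + 1) := by ring
    _ = ENNReal.ofReal η * ((n : ENNReal) + 1) := by rw [h3]

/-- Wiring check (an `example`, so that `TiltCommutation_of` stays the only theorem concluding the crux):
the registered stubs feed the skeleton theorem as stated — this term becomes the crux proof when the two
`sorry`s above are discharged (it carries `sorryAx` exactly through the two `stub_*`). -/
example : TiltCommutation := TiltCommutation_of stub_bulkPalmTilt stub_boundaryLayerMass

/-- The plain-arrow form `<stub sigs> → TiltCommutation` of the skeleton theorem (same proof term). -/
example : BulkPalmTilt → BoundaryLayerMass → TiltCommutation := TiltCommutation_of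

end Summit.AtomisticToContinuum.BoseEinsteinCondensation.Cruxes.TiltCommutation.Birth
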